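import Mathlib.MeasureTheory.Function.Jacobian
import Literature.Analysis.Calculus.RealAnalyticZeroSetAddHaar
import Mathlib.MeasureTheory.Integral.Bochner.Basic
import Mathlib.MeasureTheory.Measure.Prod

/-!
# FIBRE COORDINATES ⇒ the push-forward of a density has an EXPLICIT fibre-integral density, CONTINUOUS by dominated
# convergence over the fixed fibre space — the «straightened» special case of the change-of-variables ∕ co-area formulae
# ([EvansGariepy1992] §3.3.3 Thm 2, §3.4.3 Thm 2), proved from Mathlib's change of variables and Tonelli

Generic measure theory on finite-dimensional real spaces; every declaration is a THEOREM proved here from Mathlib (no `def`,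
no named fact, no `sorry`).  LOCATED CONSUMER (cell `pub-ymgap`, YM-PLAN Track A, node N09 [B12] width seat `pub-ymgap-dag-n09-w2`
g3, `--supports` K1⁷ `StabilityBAtRecordR13SepCoPH` = stmt-QuantumFields-20542, count-neutral helper): node00-def-K0e's located debt
(F1) «the Jacobian face of [Balaban1987RG1] (0.4)'s disintegration» (`P7-LOCATOR-AUDIT.md` §4, `F1-PROGRAMME-DESIGN.md` M4:
`integral_comp_avOfRecord_eq` «`∫ f(M V) ρ(V) dV = ∫ f(W)·step210Integral(W) dW`» and `continuousOn_step210Integral` «integral over the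
FIXED linear subspace × box — a W-INDEPENDENT domain with an integrand continuous in (B₁, W): THIS is the mechanism of every analyticity
statement of [I] §3»).  In print ([Balaban1987RG1] (2.1) → (2.10) pp. 265–267) this is the δ-function step *«We introduce new
integration variables V′ = V(V^{(k)})⁻¹ … ∫dV δ(V̄W⁻¹) χ_k exp[…] = ∫dB′ σ(B′) δ(Q̃(B′)) χ_k exp[…]»* followed by the linearising change
of variables `B′ = B − hD̃(B)` p. 267 which makes the constraint domain independent of the coarse field.  THIS FILE is that step with
EVERY model-specific object abstracted into hypotheses: a coarse space `Y`, a fibre space `K`, the fine space modelled as `Y × K`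
(a consumer identifies its configuration space with `Y × K` by a linear chart, e.g. lit-balaban p28's product exponential chart
`HaarDensitySpecialUnitaryGlobalPi.measurePreserving_pi_expChart_specialUnitaryGroup`), a «block map» `M : Y × K → Y` and FIBRE
COORDINATES `Ψ : Y × K ⊇ U → Y × K`, injective and differentiable on `U`, STRAIGHTENING the fibres: `M (Ψ (W, B)) = W`.
DIVISION OF (F1)-M4 WITH THE SIBLING SEAT dag-n09-w6 (bus HANDSHAKE-1, 2026-08-28): THIS file = the EUCLIDEAN ENGINE that PRODUCES the
change-of-variables identity and the explicit density from a C¹ injective fibre parametrisation (Lebesgue, `|det DΨ|`); their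
`Literature/…/Balaban1983to89/Node00/RegSetOfFibredChart` = the ABSTRACT-MEASURE CONSUMER side (that identity DISPLAYED as `hmap` on arbitrary
measurable spaces ⇒ `HasContVersionOn` ∕ `⊆ regSet` ∕ `TcanOfRecord` pointwise, and §5 AT NODE 00's RECORD: the `hreg` binder shape at
`domAltOfRecord`).  `restrict_preimage_inter_image_eq_map_prod_withDensity` below is `hmap` verbatim in the linear-chart model; the composition with the
group chart (p28) and the (2.10) linearisation that builds `Ψ` (M3) remain the located-open part.

WHAT IS PROVED (namespace `Literature.MeasureTheory.Integral.FibreCoordinates`; `μY`, `μK` additive Haar measures, `μY.prod μK`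
the (additive Haar) reference measure on `Y × K`).
* §1 ★★ **`lintegral_comp_mul_eq`** — for measurable `φ ≥ 0` on `Y` and a measurable density `ρ ≥ 0` on `Y × K` vanishing off
  `Ψ(U)`: `∫ φ(M x) ρ(x) d(μY ⊗ μK) = ∫_Y φ(W) · (∫_K 1_U(W,B) |det DΨ(W,B)| ρ(Ψ(W,B)) dμK) dμY` (Mathlib
  `lintegral_image_eq_lintegral_abs_det_fderiv_mul` on `U`, `M ∘ Ψ = fst`, Tonelli `lintegral_prod`);
  ★★ **`withDensity_preimage_eq_setLIntegral`** — hence `(ρ·(μY ⊗ μK))(M⁻¹ A) = ∫_A I dμY` for Borel `A ⊆ Y` with the FIBRE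
  INTEGRAL `I(W) = ∫_K 1_U(W,B) |det DΨ(W,B)| ρ(Ψ(W,B)) dμK`, and ★ **`map_withDensity_eq_withDensity`** — the push-forward
  `M_*(ρ·(μY ⊗ μK))` IS `I·μY`; ★ **`withDensity_preimage_eq_setLIntegral_of_window`** — the same above a coarse window `D` when
  `ρ` is carried by `Ψ(U)` only above `D`; ★★ **`restrict_image_eq_map_withDensity`** ∕ **`restrict_preimage_inter_image_eq_map_prod_withDensity`**
  — the change of variables as an EQUALITY OF MEASURES, `(μY ⊗ μK)⌊(M⁻¹D ∩ Ψ(U)) = Ψ_*((μY⌊D ⊗ μK⌊V)·|det Ψ'|)` for `U = D ×ˢ V`: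
  literally the «fibred chart» hypothesis (`hmap`) that the abstract regular-set criterion of pub-ymgap's `Node00/RegSetOfFibredChart`
  (dag-n09-w6) displays — SUPPLIED here in the linear-chart model.
* §2 ★★★ **`continuousOn_fibreIntegral`** — on a PRODUCT window `D ×ˢ V` (`μK V < ∞`) a real integrand `G` continuous on
  `D ×ˢ V` and bounded there has `W ↦ ∫_{B ∈ V} G(W, B) dμK` CONTINUOUS on `D` (Mathlib `continuousOn_of_dominated` — the
  W-independent domain is the whole point); ★★★ **`continuousOn_density_of_fibreCoordinates`** — §1 + §2: with `U = D ×ˢ V`,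
  `ρ = ofReal ∘ r` (`r ≥ 0` measurable) carried by `Ψ(U)` above `D`, and `(W,B) ↦ |det DΨ(W,B)| · r(Ψ(W,B))` continuous and bounded
  on `D ×ˢ V`, the push-forward `M_*(ρ·(μY ⊗ μK))` has, above `D`, the density `W ↦ ∫_{V} |det DΨ(W,B)| r(Ψ(W,B)) dμK`, which is
  CONTINUOUS on `D`.

HONEST SCOPE.  (i) Fibres must be GLOBALLY straightened by one injective C¹ parametrisation on `U` (the co-area formula proper —
Hausdorff measure on level sets of a Lipschitz map — is NOT proved or used).  (ii) Measurability of `Ψ` and of `p ↦ det DΨ(p)` on the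
whole space is assumed (a consumer with C¹ data takes `Ψ' := fderiv ℝ Ψ`, Mathlib `measurable_fderiv`).  (iii) Nothing model-specific:
the fibre map of [Balaban1987RG1] (0.4), the background `V^{(k)}(W)` and its C¹-dependence ([Balaban1985Variational] Thm 1), the
linearisation `B′ = B − hD̃(B)` (tree `B12Lineariz267`∕`B12LinearizAnalytic267`) and the group charts are the consumer's hypotheses
`Ψ`, `hΨ'`, `hinj`, `hM`; no claim about Bałaban's renormalization group, the node N09, or the Clay problem is made here.

v1.1 (same seat, APPEND-ONLY; §1–§2 byte-identical to p609518): §3 SHARP INTEGRANDS — ★★ `continuousOn_fibreIntegral_of_ae` (for each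
`W₀ ∈ D` continuity in `W` at `W₀` for `μK`-a.e. `B`, Mathlib `continuousWithinAt_of_dominated`), `ae_continuousWithinAt_of_null_fibreSet`
(that premise from a null fibre trace of a threshold set), ★ `measure_fibre_inter_zeroSet_eq_zero` (the null fibre trace for the zero set of a
functional real-analytic along the fibre ball — [Mityagin2015] by name from `Literature.Analysis.Calculus`), ★★★
`continuousOn_density_of_fibreCoordinates_of_ae` (the assembled sharp form) — where the (F2) FIBRE species of the audit meets (F1).
-/

noncomputable section

namespace Literature.MeasureTheory.Integral.FibreCoordinates

open _root_.MeasureTheory _root_.MeasureTheory.Measure Set Function Filter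
open scoped ENNReal Topology

variable {Y K : Type*}
  [NormedAddCommGroup Y] [NormedSpace ℝ Y] [FiniteDimensional ℝ Y] [MeasurableSpace Y] [BorelSpace Y]
  [NormedAddCommGroup K] [NormedSpace ℝ K] [FiniteDimensional ℝ K] [MeasurableSpace K] [BorelSpace K]
  (μY : Measure Y) [μY.IsAddHaarMeasure] (μK : Measure K) [μK.IsAddHaarMeasure]

/-! ## §1 The push-forward identity: change of variables along the fibre coordinates + Tonelli -/

section Identity

variable {U : Set (Y × K)} {Ψ : Y × K → Y × K} {Ψ' : Y × K → (Y × K →L[ℝ] Y × K)} {M : Y × K → Y}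
  {ρ : Y × K → ℝ≥0∞}

omit [FiniteDimensional ℝ Y] [BorelSpace Y] [FiniteDimensional ℝ K] [BorelSpace K] in
/-- The fibre-coordinate integrand `p ↦ 1_U(p) · |det DΨ(p)| · ρ(Ψ(p))` is measurable (under global measurability of `Ψ`,
`det DΨ` and `ρ`). [cite: EvansGariepy1992, §3.3.3 Thm 2 (fibred special case)] -/
theorem measurable_fibreIntegrand (hU : MeasurableSet U) (hΨm : Measurable Ψ) (hJ : Measurable fun p => (Ψ' p).det)
    (hρ : Measurable ρ) :
    Measurable (U.indicator fun p => ENNReal.ofReal |(Ψ' p).det| * ρ (Ψ p)) :=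
  ((ENNReal.measurable_ofReal.comp (continuous_abs.measurable.comp hJ)).mul (hρ.comp hΨm)).indicator hU

/-- ★★ **THE PUSH-FORWARD IDENTITY.**  Fibre coordinates `Ψ` on `U` (injective, differentiable with derivative `Ψ'` within `U`,
straightening the fibres of `M`: `M (Ψ p) = p.1` on `U`) and a measurable density `ρ` vanishing off `Ψ(U)`: for every measurable
`φ ≥ 0` on the coarse space,
`∫ φ(M x) ρ(x) d(μY ⊗ μK)(x) = ∫_Y φ(W) (∫_K 1_U(W,B) |det Ψ'(W,B)| ρ(Ψ(W,B)) dμK(B)) dμY(W)`.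
(Change of variables on `U` — Mathlib `lintegral_image_eq_lintegral_abs_det_fderiv_mul` — then Tonelli.)
[cite: EvansGariepy1992, §3.3.3 Thm 2 and §3.4.3 Thm 2 (fibred special case)] [cite: Balaban1987RG1, (2.1)–(2.10) pp.265–267 (measure-level reading)] -/
theorem lintegral_comp_mul_eq (hU : MeasurableSet U) (hΨ' : ∀ p ∈ U, HasFDerivWithinAt Ψ (Ψ' p) U p) (hinj : InjOn Ψ U)
    (hΨm : Measurable Ψ) (hJ : Measurable fun p => (Ψ' p).det) (hM : ∀ p ∈ U, M (Ψ p) = p.1)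
    (hρ : Measurable ρ) (hsupp : ∀ x, x ∉ Ψ '' U → ρ x = 0) {φ : Y → ℝ≥0∞} (hφ : Measurable φ) :
    ∫⁻ x, φ (M x) * ρ x ∂(μY.prod μK) =
      ∫⁻ W, φ W * ∫⁻ B, U.indicator (fun p => ENNReal.ofReal |(Ψ' p).det| * ρ (Ψ p)) (W, B) ∂μK ∂μY := by
  set μ : Measure (Y × K) := μY.prod μK with hμ
  have hF := measurable_fibreIntegrand hU hΨm hJ hρ
  -- the integrand lives on `Ψ '' U`
  have hg : (fun x => φ (M x) * ρ x) = (Ψ '' U).indicator (fun x => φ (M x) * ρ x) := by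
    funext x
    by_cases hx : x ∈ Ψ '' U
    · rw [indicator_of_mem hx]
    · rw [indicator_of_notMem hx, hsupp x hx, mul_zero]
  rw [hg, lintegral_indicator (measurable_image_of_fderivWithin hU hΨ' hinj),
    lintegral_image_eq_lintegral_abs_det_fderiv_mul μ hU hΨ' hinj]
  -- `M ∘ Ψ = fst` on `U`
  have h2 : ∫⁻ p in U, ENNReal.ofReal |(Ψ' p).det| * (φ (M (Ψ p)) * ρ (Ψ p)) ∂μ =
      ∫⁻ p in U, φ p.1 * (ENNReal.ofReal |(Ψ' p).det| * ρ (Ψ p)) ∂μ := by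
    refine setLIntegral_congr_fun hU (fun p hp => ?_)
    simp only [hM p hp]
    ring
  rw [h2, ← lintegral_indicator hU]
  have h3 : U.indicator (fun p => φ p.1 * (ENNReal.ofReal |(Ψ' p).det| * ρ (Ψ p))) =
      fun p => φ p.1 * U.indicator (fun p => ENNReal.ofReal |(Ψ' p).det| * ρ (Ψ p)) p := by
    funext p
    by_cases hp : p ∈ U
    · rw [indicator_of_mem hp, indicator_of_mem hp]
    · rw [indicator_of_notMem hp, indicator_of_notMem hp, mul_zero]
  have hmeas : Measurable (fun p : Y × K =>
      φ p.1 * U.indicator (fun p => ENNReal.ofReal |(Ψ' p).det| * ρ (Ψ p)) p) :=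
    (hφ.comp measurable_fst).mul hF
  rw [h3, hμ, lintegral_prod _ hmeas.aemeasurable]
  refine lintegral_congr (fun W => ?_)
  have hW : Measurable (fun B : K => U.indicator (fun p => ENNReal.ofReal |(Ψ' p).det| * ρ (Ψ p)) (W, B)) :=
    hF.comp measurable_prodMk_left
  exact lintegral_const_mul (φ W) hW

/-- ★★ **THE PUSH-FORWARD HAS THE FIBRE-INTEGRAL DENSITY**: for every Borel `A ⊆ Y`,
`(ρ·(μY ⊗ μK))(M⁻¹ A) = ∫_A I dμY`, `I(W) = ∫_K 1_U(W,B) |det Ψ'(W,B)| ρ(Ψ(W,B)) dμK(B)`.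
[cite: EvansGariepy1992, §3.4.3 Thm 2 (fibred special case)] [cite: Balaban1987RG1, (2.1)–(2.10) pp.265–267 (measure-level reading)] -/
theorem withDensity_preimage_eq_setLIntegral (hU : MeasurableSet U) (hΨ' : ∀ p ∈ U, HasFDerivWithinAt Ψ (Ψ' p) U p)
    (hinj : InjOn Ψ U) (hΨm : Measurable Ψ) (hJ : Measurable fun p => (Ψ' p).det)
    (hMm : Measurable M) (hM : ∀ p ∈ U, M (Ψ p) = p.1)
    (hρ : Measurable ρ) (hsupp : ∀ x, x ∉ Ψ '' U → ρ x = 0) {A : Set Y} (hA : MeasurableSet A) :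
    ((μY.prod μK).withDensity ρ) (M ⁻¹' A) =
      ∫⁻ W in A, ∫⁻ B, U.indicator (fun p => ENNReal.ofReal |(Ψ' p).det| * ρ (Ψ p)) (W, B) ∂μK ∂μY := by
  rw [withDensity_apply _ (hMm hA), ← lintegral_indicator (hMm hA)]
  have h1 : (M ⁻¹' A).indicator ρ = fun x => A.indicator (fun _ => (1 : ℝ≥0∞)) (M x) * ρ x := by
    funext x
    by_cases hx : M x ∈ A
    · rw [indicator_of_mem (show x ∈ M ⁻¹' A from hx), indicator_of_mem hx, one_mul]
    · rw [indicator_of_notMem (show x ∉ M ⁻¹' A from hx), indicator_of_notMem hx, zero_mul]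
  rw [h1, lintegral_comp_mul_eq μY μK hU hΨ' hinj hΨm hJ hM hρ hsupp (measurable_const.indicator hA),
    ← lintegral_indicator hA]
  refine lintegral_congr (fun W => ?_)
  by_cases hW : W ∈ A
  · rw [indicator_of_mem hW, indicator_of_mem hW, one_mul]
  · rw [indicator_of_notMem hW, indicator_of_notMem hW, zero_mul]

/-- ★ **THE PUSH-FORWARD AS A MEASURE**: `M_*(ρ·(μY ⊗ μK)) = I·μY` with the fibre integral `I` of the previous theorem.
[cite: EvansGariepy1992, §3.4.3 Thm 2 (fibred special case)] -/
theorem map_withDensity_eq_withDensity (hU : MeasurableSet U) (hΨ' : ∀ p ∈ U, HasFDerivWithinAt Ψ (Ψ' p) U p)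
    (hinj : InjOn Ψ U) (hΨm : Measurable Ψ) (hJ : Measurable fun p => (Ψ' p).det)
    (hMm : Measurable M) (hM : ∀ p ∈ U, M (Ψ p) = p.1)
    (hρ : Measurable ρ) (hsupp : ∀ x, x ∉ Ψ '' U → ρ x = 0) :
    ((μY.prod μK).withDensity ρ).map M =
      μY.withDensity (fun W => ∫⁻ B, U.indicator (fun p => ENNReal.ofReal |(Ψ' p).det| * ρ (Ψ p)) (W, B) ∂μK) := by
  refine Measure.ext (fun A hA => ?_)
  rw [Measure.map_apply hMm hA, withDensity_apply _ hA]
  exact withDensity_preimage_eq_setLIntegral μY μK hU hΨ' hinj hΨm hJ hMm hM hρ hsupp hA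

/-- ★ **WINDOWED FORM**: if `ρ` is carried by `Ψ(U)` only ABOVE a coarse window `D` (`M x ∈ D`, `ρ x ≠ 0 ⇒ x ∈ Ψ(U)`), the density
identity holds for every Borel `A ⊆ D`. [cite: EvansGariepy1992, §3.4.3 Thm 2 (fibred special case)]
[cite: Balaban1987RG1, (2.1)–(2.10) pp.265–267 (measure-level reading)] -/
theorem withDensity_preimage_eq_setLIntegral_of_window (hU : MeasurableSet U)
    (hΨ' : ∀ p ∈ U, HasFDerivWithinAt Ψ (Ψ' p) U p) (hinj : InjOn Ψ U) (hΨm : Measurable Ψ)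
    (hJ : Measurable fun p => (Ψ' p).det) (hMm : Measurable M) (hM : ∀ p ∈ U, M (Ψ p) = p.1) (hρ : Measurable ρ)
    {D : Set Y} (hD : MeasurableSet D) (hsupp : ∀ x, M x ∈ D → x ∉ Ψ '' U → ρ x = 0)
    {A : Set Y} (hA : MeasurableSet A) (hAD : A ⊆ D) :
    ((μY.prod μK).withDensity ρ) (M ⁻¹' A) =
      ∫⁻ W in A, ∫⁻ B, U.indicator (fun p => ENNReal.ofReal |(Ψ' p).det| * ρ (Ψ p)) (W, B) ∂μK ∂μY := by
  -- cut `ρ` down to the window: `ρ' = 1_{M⁻¹ D} ρ` is carried by `Ψ(U)` everywhere and agrees with `ρ` above `A ⊆ D`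
  set ρ' : Y × K → ℝ≥0∞ := (M ⁻¹' D).indicator ρ with hρ'
  have hρ'm : Measurable ρ' := hρ.indicator (hMm hD)
  have hsupp' : ∀ x, x ∉ Ψ '' U → ρ' x = 0 := by
    intro x hx
    by_cases hxD : M x ∈ D
    · rw [hρ', indicator_of_mem (show x ∈ M ⁻¹' D from hxD)]; exact hsupp x hxD hx
    · rw [hρ', indicator_of_notMem (show x ∉ M ⁻¹' D from hxD)]
  -- left-hand sides agree
  have hL : ((μY.prod μK).withDensity ρ) (M ⁻¹' A) = ((μY.prod μK).withDensity ρ') (M ⁻¹' A) := by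
    rw [withDensity_apply _ (hMm hA), withDensity_apply _ (hMm hA)]
    refine setLIntegral_congr_fun (hMm hA) (fun x hx => ?_)
    rw [hρ', indicator_of_mem (show x ∈ M ⁻¹' D from hAD hx)]
  -- right-hand sides agree on `A`
  have hR : ∀ W ∈ A, (∫⁻ B, U.indicator (fun p => ENNReal.ofReal |(Ψ' p).det| * ρ (Ψ p)) (W, B) ∂μK) =
      ∫⁻ B, U.indicator (fun p => ENNReal.ofReal |(Ψ' p).det| * ρ' (Ψ p)) (W, B) ∂μK := by
    intro W hW
    refine lintegral_congr (fun B => ?_)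
    by_cases hp : (W, B) ∈ U
    · rw [indicator_of_mem hp, indicator_of_mem hp, hρ',
        indicator_of_mem (show Ψ (W, B) ∈ M ⁻¹' D by
          show M (Ψ (W, B)) ∈ D
          rw [hM _ hp]; exact hAD hW)]
    · rw [indicator_of_notMem hp, indicator_of_notMem hp]
  rw [hL, withDensity_preimage_eq_setLIntegral μY μK hU hΨ' hinj hΨm hJ hMm hM hρ'm hsupp' hA]
  exact (setLIntegral_congr_fun hA (fun W hW => (hR W hW).symm))

/-- ★★ **THE CHANGE-OF-VARIABLES IDENTITY AS AN EQUALITY OF MEASURES** (the «fibred chart» hypothesis a consumer of the abstract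
transport displays — e.g. `hmap` of pub-ymgap's `Node00/RegSetOfFibredChart` — SUPPLIED in the linear-chart model): the reference measure
restricted to the image `Ψ(U)` is the push-forward under `Ψ` of the reference measure restricted to `U` with density `|det Ψ'|`.  Plain
`Measure.map` form of Mathlib's `restrict_map_withDensity_abs_det_fderiv_eq_addHaar`.
[cite: EvansGariepy1992, §3.3.3 Thm 2 (fibred special case)] -/
theorem restrict_image_eq_map_withDensity (hU : MeasurableSet U) (hΨ' : ∀ p ∈ U, HasFDerivWithinAt Ψ (Ψ' p) U p)
    (hinj : InjOn Ψ U) (hΨm : Measurable Ψ) (hJ : Measurable fun p => (Ψ' p).det) :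
    (μY.prod μK).restrict (Ψ '' U) =
      (((μY.prod μK).restrict U).withDensity fun p => ENNReal.ofReal |(Ψ' p).det|).map Ψ := by
  set μ : Measure (Y × K) := μY.prod μK with hμ
  have hJ' : Measurable fun p => ENNReal.ofReal |(Ψ' p).det| :=
    ENNReal.measurable_ofReal.comp (continuous_abs.measurable.comp hJ)
  refine Measure.ext (fun E hE => ?_)
  rw [Measure.map_apply hΨm hE, withDensity_apply _ (hΨm hE), Measure.restrict_restrict (hΨm hE),
    Measure.restrict_apply hE]
  calc μ (E ∩ Ψ '' U) = ∫⁻ x in Ψ '' U, E.indicator (fun _ => (1 : ℝ≥0∞)) x ∂μ := by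
        rw [lintegral_indicator hE, Measure.restrict_restrict hE, setLIntegral_one]
    _ = ∫⁻ p in U, ENNReal.ofReal |(Ψ' p).det| * E.indicator (fun _ => (1 : ℝ≥0∞)) (Ψ p) ∂μ :=
        lintegral_image_eq_lintegral_abs_det_fderiv_mul μ hU hΨ' hinj _
    _ = ∫⁻ p in U, (Ψ ⁻¹' E).indicator (fun p => ENNReal.ofReal |(Ψ' p).det|) p ∂μ := by
        refine setLIntegral_congr_fun hU (fun p _ => ?_)
        by_cases hpE : Ψ p ∈ E
        · rw [indicator_of_mem hpE, indicator_of_mem (show p ∈ Ψ ⁻¹' E from hpE), mul_one]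
        · rw [indicator_of_notMem hpE, indicator_of_notMem (show p ∉ Ψ ⁻¹' E from hpE), mul_zero]
    _ = ∫⁻ p in Ψ ⁻¹' E ∩ U, ENNReal.ofReal |(Ψ' p).det| ∂μ := by
        rw [lintegral_indicator (hΨm hE), Measure.restrict_restrict (hΨm hE)]

/-- ★★ **THE SAME ABOVE A COARSE WINDOW, PRODUCT FORM**: with `U = D ×ˢ V` and fibres straightened over `D` (`M ∘ Ψ = fst` on `U`), the fine
reference measure restricted to `M⁻¹ D ∩ Ψ(U)` (the configurations above the window reached by the chart) is
`Ψ_* ((μY⌊D ⊗ μK⌊V) · |det Ψ'|)` — literally the displayed fibred-chart hypothesis of the abstract regular-set criterion.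
[cite: EvansGariepy1992, §3.3.3 Thm 2 (fibred special case)] [cite: Balaban1987RG1, (2.1)–(2.10) pp.265–267 (measure-level reading)] -/
theorem restrict_preimage_inter_image_eq_map_prod_withDensity {D : Set Y} {V : Set K} (hD : MeasurableSet D)
    (hV : MeasurableSet V) (hUDV : U = D ×ˢ V) (hΨ' : ∀ p ∈ U, HasFDerivWithinAt Ψ (Ψ' p) U p) (hinj : InjOn Ψ U)
    (hΨm : Measurable Ψ) (hJ : Measurable fun p => (Ψ' p).det) (hM : ∀ p ∈ U, M (Ψ p) = p.1) :
    (μY.prod μK).restrict (M ⁻¹' D ∩ Ψ '' U) =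
      (((μY.restrict D).prod (μK.restrict V)).withDensity fun p => ENNReal.ofReal |(Ψ' p).det|).map Ψ := by
  have hU : MeasurableSet U := by rw [hUDV]; exact hD.prod hV
  have himg : M ⁻¹' D ∩ Ψ '' U = Ψ '' U := by
    refine Set.inter_eq_right.2 ?_
    rintro x ⟨p, hp, rfl⟩
    show M (Ψ p) ∈ D
    rw [hM p hp]
    rw [hUDV] at hp
    exact hp.1
  rw [himg, Measure.prod_restrict, ← hUDV]
  exact restrict_image_eq_map_withDensity μY μK hU hΨ' hinj hΨm hJ

end Identity

/-! ## §2 Continuity of the fibre integral over a FIXED fibre window (dominated convergence) -/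

section Continuity

omit [NormedSpace ℝ Y] [FiniteDimensional ℝ Y] [MeasurableSpace Y] [BorelSpace Y] [NormedSpace ℝ K] [FiniteDimensional ℝ K]
  [μK.IsAddHaarMeasure] in
/-- ★★★ **CONTINUITY OVER THE FIXED FIBRE SPACE**: on a product window `D ×ˢ V` with `μK V < ∞`, a real integrand `G` that is
continuous on `D ×ˢ V` and bounded there by `C` has `W ↦ ∫_{B ∈ V} G(W, B) dμK` continuous on `D` — dominated convergence with the
constant majorant; the fibre domain `V` does NOT move with `W`, which is exactly what the linearising change of variables buys.
[cite: EvansGariepy1992, §3.4.3 Thm 2 (fibred special case)] [cite: Balaban1987RG1, (2.10) p.267 (measure-level reading)] -/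
theorem continuousOn_fibreIntegral {D : Set Y} {V : Set K} (hV : MeasurableSet V) (hVfin : μK V ≠ ∞)
    {G : Y × K → ℝ} (hG : ContinuousOn G (D ×ˢ V)) {C : ℝ} (hC : ∀ p ∈ D ×ˢ V, ‖G p‖ ≤ C) :
    ContinuousOn (fun W => ∫ B in V, G (W, B) ∂μK) D := by
  haveI : IsFiniteMeasure (μK.restrict V) := ⟨by rwa [Measure.restrict_apply_univ, lt_top_iff_ne_top]⟩
  refine continuousOn_of_dominated (bound := fun _ => C) ?_ ?_ (integrable_const C) ?_
  · intro W hW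
    have hsec : ContinuousOn (fun B => G (W, B)) V :=
      hG.comp (Continuous.continuousOn (by fun_prop)) (fun B hB => ⟨hW, hB⟩)
    exact hsec.aestronglyMeasurable hV
  · intro W hW
    exact (ae_restrict_iff' hV).2 (Eventually.of_forall fun B hB => hC (W, B) ⟨hW, hB⟩)
  · refine (ae_restrict_iff' hV).2 (Eventually.of_forall fun B hB => ?_)
    exact hG.comp (Continuous.continuousOn (by fun_prop)) (fun W hW => ⟨hW, hB⟩)

variable {U : Set (Y × K)} {Ψ : Y × K → Y × K} {Ψ' : Y × K → (Y × K →L[ℝ] Y × K)} {M : Y × K → Y}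

/-- ★★★ **FIBRE COORDINATES ⇒ A CONTINUOUS PUSH-FORWARD DENSITY** (§1 + §2).  Window `U = D ×ˢ V` (`D`, `V` Borel, `μK V < ∞`),
fibre coordinates `Ψ` on `U` straightening `M`, a real density `r ≥ 0` (measurable) whose `ρ = ofReal ∘ r` is carried by `Ψ(U)` above
`D`, and the fibre integrand `(W, B) ↦ |det Ψ'(W,B)| · r(Ψ(W,B))` continuous on `D ×ˢ V` and bounded there.  Then ABOVE `D` the
push-forward `M_*(ρ·(μY ⊗ μK))` has the density `I(W) = ∫_{V} |det Ψ'(W,B)| r(Ψ(W,B)) dμK(B)`: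
`(ρ·(μY ⊗ μK))(M⁻¹ A) = ∫_A ofReal (I W) dμY(W)` for every Borel `A ⊆ D`, AND `I` IS CONTINUOUS ON `D`.
[cite: EvansGariepy1992, §3.3.3 Thm 2 and §3.4.3 Thm 2 (fibred special case)] [cite: Balaban1987RG1, (2.1)–(2.10) pp.265–267 (measure-level reading)] -/
theorem continuousOn_density_of_fibreCoordinates {D : Set Y} {V : Set K} (hD : MeasurableSet D) (hV : MeasurableSet V)
    (hVfin : μK V ≠ ∞) (hUDV : U = D ×ˢ V)
    (hΨ' : ∀ p ∈ U, HasFDerivWithinAt Ψ (Ψ' p) U p) (hinj : InjOn Ψ U) (hΨm : Measurable Ψ)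
    (hJ : Measurable fun p => (Ψ' p).det) (hMm : Measurable M) (hM : ∀ p ∈ U, M (Ψ p) = p.1)
    {r : Y × K → ℝ} (hr : Measurable r) (hr0 : ∀ x, 0 ≤ r x)
    (hsupp : ∀ x, M x ∈ D → x ∉ Ψ '' U → r x = 0)
    (hcont : ContinuousOn (fun p => |(Ψ' p).det| * r (Ψ p)) (D ×ˢ V))
    {C : ℝ} (hC : ∀ p ∈ D ×ˢ V, |(Ψ' p).det| * r (Ψ p) ≤ C) :
    ContinuousOn (fun W => ∫ B in V, |(Ψ' (W, B)).det| * r (Ψ (W, B)) ∂μK) D ∧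
      ∀ A : Set Y, MeasurableSet A → A ⊆ D →
        ((μY.prod μK).withDensity (fun x => ENNReal.ofReal (r x))) (M ⁻¹' A) =
          ∫⁻ W in A, ENNReal.ofReal (∫ B in V, |(Ψ' (W, B)).det| * r (Ψ (W, B)) ∂μK) ∂μY := by
  have hU : MeasurableSet U := by rw [hUDV]; exact hD.prod hV
  have hnn : ∀ p, 0 ≤ |(Ψ' p).det| * r (Ψ p) := fun p => mul_nonneg (abs_nonneg _) (hr0 _)
  refine ⟨?_, fun A hA hAD => ?_⟩
  · refine continuousOn_fibreIntegral μK hV hVfin (G := fun p => |(Ψ' p).det| * r (Ψ p)) hcont (C := C) ?_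
    intro p hp
    rw [Real.norm_of_nonneg (hnn p)]
    exact hC p hp
  · have hρ : Measurable fun x => ENNReal.ofReal (r x) := ENNReal.measurable_ofReal.comp hr
    have hsupp' : ∀ x, M x ∈ D → x ∉ Ψ '' U → ENNReal.ofReal (r x) = 0 := fun x hxD hx => by
      rw [hsupp x hxD hx, ENNReal.ofReal_zero]
    rw [withDensity_preimage_eq_setLIntegral_of_window μY μK hU hΨ' hinj hΨm hJ hMm hM hρ hD hsupp' hA hAD]
    refine setLIntegral_congr_fun hA (fun W hW => ?_)
    -- the fibre integrand above `W ∈ D`: `1_U(W,B)·ofReal|det|·ofReal r = 1_V(B)·ofReal(|det|·r)`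
    have hWD : W ∈ D := hAD hW
    have hind : (fun B => U.indicator (fun p => ENNReal.ofReal |(Ψ' p).det| * ENNReal.ofReal (r (Ψ p))) (W, B)) =
        V.indicator (fun B => ENNReal.ofReal (|(Ψ' (W, B)).det| * r (Ψ (W, B)))) := by
      funext B
      by_cases hB : B ∈ V
      · have hp : (W, B) ∈ U := by rw [hUDV]; exact ⟨hWD, hB⟩
        rw [indicator_of_mem hp, indicator_of_mem hB, ENNReal.ofReal_mul (abs_nonneg _)]
      · have hp : (W, B) ∉ U := by rw [hUDV]; exact fun h => hB h.2
        rw [indicator_of_notMem hp, indicator_of_notMem hB]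
    rw [hind, lintegral_indicator hV]
    -- bounded continuous integrand on a finite-measure window: the Bochner integral is the lintegral
    haveI : IsFiniteMeasure (μK.restrict V) := ⟨by rwa [Measure.restrict_apply_univ, lt_top_iff_ne_top]⟩
    have hsec : ContinuousOn (fun B => |(Ψ' (W, B)).det| * r (Ψ (W, B))) V :=
      hcont.comp (Continuous.continuousOn (by fun_prop)) (fun B hB => ⟨hWD, hB⟩)
    have hint : Integrable (fun B => |(Ψ' (W, B)).det| * r (Ψ (W, B))) (μK.restrict V) := by
      refine Integrable.of_bound (hsec.aestronglyMeasurable hV) C ?_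
      exact (ae_restrict_iff' hV).2 (Eventually.of_forall fun B hB => by
        rw [Real.norm_of_nonneg (hnn (W, B))]; exact hC (W, B) ⟨hWD, hB⟩)
    rw [ofReal_integral_eq_lintegral_ofReal hint (Eventually.of_forall fun B => hnn (W, B))]

end Continuity

/-! ## §3 (v1.1, same seat, APPEND-ONLY) SHARP integrands: fibrewise-a.e. continuity suffices — where the (F2) fibre species meets (F1)

A density with a SHARP small-field indicator (node00-def-K0e `P7-LOCATOR-AUDIT.md` §4 (F2): *«the SHARP 𝟙_{domAlt_k} is integrated over
fibres: for fixed V₀ the configurations U_int whose fibre point has a fine plaquette EXACTLY at threshold ε₀ must be null»*) is not jointly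
continuous, but for each coarse point `W₀` it is continuous in `W` at `W₀` for `μK`-almost every fibre parameter `B` — as soon as the
threshold set meets the fibre over `W₀` in a `μK`-null set.  Dominated convergence needs no more (Mathlib `continuousWithinAt_of_dominated`,
point by point), and for a threshold set cut out by a real-analytic functional the fibre nullity is [Mityagin2015] on the fibre ball
(the tree's `Literature.Analysis.Calculus.addHaar_zeroSet_eq_zero_of_analyticOnNhd`). -/

section Sharp

omit [NormedSpace ℝ Y] [FiniteDimensional ℝ Y] [MeasurableSpace Y] [BorelSpace Y] [NormedAddCommGroup K] [NormedSpace ℝ K]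
  [FiniteDimensional ℝ K] [BorelSpace K] [μK.IsAddHaarMeasure] in
/-- ★★ **CONTINUITY OVER THE FIXED FIBRE WINDOW, SHARP FORM**: on `D ×ˢ V` (`μK V < ∞`) a real integrand `G`, measurable in `B` for each
`W ∈ D`, bounded by `C`, and such that FOR EACH `W₀ ∈ D` the map `W ↦ G(W, B)` is continuous at `W₀` within `D` for `μK`-ALMOST EVERY
`B ∈ V` (the exceptional `B` may depend on `W₀`), has `W ↦ ∫_{B ∈ V} G(W,B) dμK` continuous on `D`.
[cite: EvansGariepy1992, §3.4.3 Thm 2 (fibred special case)] [cite: Balaban1987RG1, (2.10) p.267 (measure-level reading)] -/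
theorem continuousOn_fibreIntegral_of_ae {D : Set Y} {V : Set K} (hV : MeasurableSet V) (hVfin : μK V ≠ ∞)
    {G : Y × K → ℝ} (hGm : ∀ W ∈ D, AEStronglyMeasurable (fun B => G (W, B)) (μK.restrict V))
    {C : ℝ} (hC : ∀ p ∈ D ×ˢ V, ‖G p‖ ≤ C)
    (hcont : ∀ W₀ ∈ D, ∀ᵐ B ∂(μK.restrict V), ContinuousWithinAt (fun W => G (W, B)) D W₀) :
    ContinuousOn (fun W => ∫ B in V, G (W, B) ∂μK) D := by
  haveI : IsFiniteMeasure (μK.restrict V) := ⟨by rwa [Measure.restrict_apply_univ, lt_top_iff_ne_top]⟩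
  intro W₀ hW₀
  refine continuousWithinAt_of_dominated (bound := fun _ => C) ?_ ?_ (integrable_const C) (hcont W₀ hW₀)
  · exact eventually_nhdsWithin_of_forall fun W hW => hGm W hW
  · exact eventually_nhdsWithin_of_forall fun W hW =>
      (ae_restrict_iff' hV).2 (Eventually.of_forall fun B hB => hC (W, B) ⟨hW, hB⟩)

omit [NormedSpace ℝ Y] [FiniteDimensional ℝ Y] [MeasurableSpace Y] [BorelSpace Y] [NormedAddCommGroup K] [NormedSpace ℝ K]
  [FiniteDimensional ℝ K] [BorelSpace K] [μK.IsAddHaarMeasure] in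
/-- **THE a.e. PREMISE FROM A NULL FIBRE TRACE**: if a «threshold set» `Z ⊆ Y × K` meets the fibre window over `W₀` in a `μK`-null set of
parameters and `W ↦ G(W,B)` is continuous at `W₀` within `D` whenever `(W₀, B) ∉ Z`, then the sharp-form premise of
`continuousOn_fibreIntegral_of_ae` holds at `W₀`. [cite: EvansGariepy1992, §3.4.3 Thm 2 (fibred special case)] -/
theorem ae_continuousWithinAt_of_null_fibreSet {D : Set Y} {V : Set K} (hV : MeasurableSet V) {G : Y × K → ℝ}
    {Z : Set (Y × K)} {W₀ : Y} (hZ : μK {B | B ∈ V ∧ (W₀, B) ∈ Z} = 0)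
    (hc : ∀ B ∈ V, (W₀, B) ∉ Z → ContinuousWithinAt (fun W => G (W, B)) D W₀) :
    ∀ᵐ B ∂(μK.restrict V), ContinuousWithinAt (fun W => G (W, B)) D W₀ := by
  rw [ae_restrict_iff' hV, ae_iff]
  refine measure_mono_null (fun B hB => ?_) hZ
  simp only [Set.mem_setOf_eq, Classical.not_imp] at hB
  exact ⟨hB.1, by_contra fun hZ' => hB.2 (hc B hB.1 hZ')⟩

omit [NormedAddCommGroup Y] [NormedSpace ℝ Y] [FiniteDimensional ℝ Y] [MeasurableSpace Y] [BorelSpace Y] in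
/-- ★ **NULL FIBRE TRACE OF AN ANALYTIC THRESHOLD SET** (the (F2) FIBRE species): if along the fibre window over `W₀` the threshold functional
read through the fibre coordinates, `B ↦ g(Ψ(W₀, B))`, is REAL-ANALYTIC on an open connected `V` and non-zero at ONE `B₀ ∈ V`, then the
parameters `B ∈ V` whose fibre point lies on the threshold set `{g = 0}` form a `μK`-null set — [Mityagin2015] on the fibre, by name from
`Literature.Analysis.Calculus.addHaar_zeroSet_eq_zero_of_analyticOnNhd`.  (Analyticity of the fibre section is the consumer's input: an
analytic block map has analytic implicit-function fibre coordinates.) [cite: Mityagin2015, Proposition 1] -/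
theorem measure_fibre_inter_zeroSet_eq_zero {V : Set K} (hVo : IsOpen V) (hVc : IsConnected V) {Ψ : Y × K → Y × K}
    {g : Y × K → ℝ} {W₀ : Y} (han : AnalyticOnNhd ℝ (fun B => g (Ψ (W₀, B))) V) (hne : ∃ B₀ ∈ V, g (Ψ (W₀, B₀)) ≠ 0) :
    μK {B | B ∈ V ∧ (W₀, B) ∈ {p : Y × K | g (Ψ p) = 0}} = 0 := by
  exact Literature.Analysis.Calculus.addHaar_zeroSet_eq_zero_of_analyticOnNhd (η := μK) hVo hVc han hne

variable {U : Set (Y × K)} {Ψ : Y × K → Y × K} {Ψ' : Y × K → (Y × K →L[ℝ] Y × K)} {M : Y × K → Y}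

/-- ★★★ **FIBRE COORDINATES ⇒ A CONTINUOUS PUSH-FORWARD DENSITY, SHARP FORM** (§1 + `continuousOn_fibreIntegral_of_ae`).  As
`continuousOn_density_of_fibreCoordinates`, but the fibre integrand `(W, B) ↦ |det Ψ'(W,B)| · r(Ψ(W,B))` is only required to be BOUNDED on
`D ×ˢ V` and, for each `W₀ ∈ D`, continuous in `W` at `W₀` within `D` for `μK`-a.e. `B ∈ V` — the form met by a density carrying a sharp
indicator whose threshold set has null trace on every fibre (`ae_continuousWithinAt_of_null_fibreSet`, `measure_fibre_inter_zeroSet_eq_zero`).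
Conclusion: above `D` the push-forward `M_*(ρ·(μY ⊗ μK))`, `ρ = ofReal ∘ r`, has the density `W ↦ ∫_V |det Ψ'(W,B)| r(Ψ(W,B)) dμK`,
CONTINUOUS on `D`. [cite: EvansGariepy1992, §3.3.3 Thm 2 and §3.4.3 Thm 2 (fibred special case)] [cite: Balaban1987RG1, (2.1)–(2.10) pp.265–267 (measure-level reading)] -/
theorem continuousOn_density_of_fibreCoordinates_of_ae {D : Set Y} {V : Set K} (hD : MeasurableSet D) (hV : MeasurableSet V)
    (hVfin : μK V ≠ ∞) (hUDV : U = D ×ˢ V)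
    (hΨ' : ∀ p ∈ U, HasFDerivWithinAt Ψ (Ψ' p) U p) (hinj : InjOn Ψ U) (hΨm : Measurable Ψ)
    (hJ : Measurable fun p => (Ψ' p).det) (hMm : Measurable M) (hM : ∀ p ∈ U, M (Ψ p) = p.1)
    {r : Y × K → ℝ} (hr : Measurable r) (hr0 : ∀ x, 0 ≤ r x)
    (hsupp : ∀ x, M x ∈ D → x ∉ Ψ '' U → r x = 0)
    (hcont : ∀ W₀ ∈ D, ∀ᵐ B ∂(μK.restrict V),
      ContinuousWithinAt (fun W => |(Ψ' (W, B)).det| * r (Ψ (W, B))) D W₀)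
    {C : ℝ} (hC : ∀ p ∈ D ×ˢ V, |(Ψ' p).det| * r (Ψ p) ≤ C) :
    ContinuousOn (fun W => ∫ B in V, |(Ψ' (W, B)).det| * r (Ψ (W, B)) ∂μK) D ∧
      ∀ A : Set Y, MeasurableSet A → A ⊆ D →
        ((μY.prod μK).withDensity (fun x => ENNReal.ofReal (r x))) (M ⁻¹' A) =
          ∫⁻ W in A, ENNReal.ofReal (∫ B in V, |(Ψ' (W, B)).det| * r (Ψ (W, B)) ∂μK) ∂μY := by
  have hU : MeasurableSet U := by rw [hUDV]; exact hD.prod hV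
  have hnn : ∀ p, 0 ≤ |(Ψ' p).det| * r (Ψ p) := fun p => mul_nonneg (abs_nonneg _) (hr0 _)
  -- the real fibre integrand is (globally) measurable, hence every section is
  have hGm : Measurable fun p : Y × K => |(Ψ' p).det| * r (Ψ p) :=
    (continuous_abs.measurable.comp hJ).mul (hr.comp hΨm)
  have hsecm : ∀ W, Measurable fun B : K => |(Ψ' (W, B)).det| * r (Ψ (W, B)) := fun W =>
    hGm.comp measurable_prodMk_left
  refine ⟨?_, fun A hA hAD => ?_⟩
  · refine continuousOn_fibreIntegral_of_ae μK hV hVfin (G := fun p => |(Ψ' p).det| * r (Ψ p))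
      (fun W _ => (hsecm W).aestronglyMeasurable) (C := C) ?_ hcont
    intro p hp
    rw [Real.norm_of_nonneg (hnn p)]
    exact hC p hp
  · have hρ : Measurable fun x => ENNReal.ofReal (r x) := ENNReal.measurable_ofReal.comp hr
    have hsupp' : ∀ x, M x ∈ D → x ∉ Ψ '' U → ENNReal.ofReal (r x) = 0 := fun x hxD hx => by
      rw [hsupp x hxD hx, ENNReal.ofReal_zero]
    rw [withDensity_preimage_eq_setLIntegral_of_window μY μK hU hΨ' hinj hΨm hJ hMm hM hρ hD hsupp' hA hAD]
    refine setLIntegral_congr_fun hA (fun W hW => ?_)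
    have hWD : W ∈ D := hAD hW
    have hind : (fun B => U.indicator (fun p => ENNReal.ofReal |(Ψ' p).det| * ENNReal.ofReal (r (Ψ p))) (W, B)) =
        V.indicator (fun B => ENNReal.ofReal (|(Ψ' (W, B)).det| * r (Ψ (W, B)))) := by
      funext B
      by_cases hB : B ∈ V
      · have hp : (W, B) ∈ U := by rw [hUDV]; exact ⟨hWD, hB⟩
        rw [indicator_of_mem hp, indicator_of_mem hB, ENNReal.ofReal_mul (abs_nonneg _)]
      · have hp : (W, B) ∉ U := by rw [hUDV]; exact fun h => hB h.2
        rw [indicator_of_notMem hp, indicator_of_notMem hB]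
    rw [hind, lintegral_indicator hV]
    haveI : IsFiniteMeasure (μK.restrict V) := ⟨by rwa [Measure.restrict_apply_univ, lt_top_iff_ne_top]⟩
    have hint : Integrable (fun B => |(Ψ' (W, B)).det| * r (Ψ (W, B))) (μK.restrict V) := by
      refine Integrable.of_bound (hsecm W).aestronglyMeasurable C ?_
      exact (ae_restrict_iff' hV).2 (Eventually.of_forall fun B hB => by
        rw [Real.norm_of_nonneg (hnn (W, B))]; exact hC (W, B) ⟨hWD, hB⟩)
    rw [ofReal_integral_eq_lintegral_ofReal hint (Eventually.of_forall fun B => hnn (W, B))]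

end Sharp

end Literature.MeasureTheory.Integral.FibreCoordinates

end
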